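import Summits.QuantumAdvantage.QuantumAdvantage.Theses.CubicForrelation
import Literature.Computability.QuantumComplexity.SignedCubicForrelation
import Literature.Computability.QuantumComplexity.CubicForrelationEstimatorMachine
import Literature.Computability.Complexity.PromiseZPPProofs

/-!
# Support item `SignedExactCubicForrelationInPrBPP` (stmt-QuantumAdvantage-14671) — glue and plumbing
(route `CubicForrelation`, rank 9)

The item (filed 2026-08-16 by the crux-plan seat of r3, idea `stationary-flat-sign`) is the statement

  `(⟨encode '' {I | IsOverB2 ∧ value = 1 ∧ k = 2 ∧ Even n ∧ ∀ i, IsDegLeFun 3 (C i).eval},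
     encode '' {I | IsOverB2 ∧ value = -1 ∧ …}⟩ : PromiseProblem) ∈ PromiseBPP'`,

i.e. the signed EXACT slice of cubic 2-fold Forrelation (YES `Φ = 1`: `b` bent with cubic dual `a`;
NO `Φ = -1`: `a = b̃ ⊕ 1`) IS in textbook promise-`BPP`. This file records, kernel-checked, where the
item sits in the route and the generic machine-side wrapper every refutation-direction line of crux r3
ends with:

* `SignedExactCubicForrelationInPrBPP_iff` — the route decl (rendered 2026-08-16T05:55Z, rev 8) is
  `signedExactCubicForrelationProblem 2 ∈ PromiseBPP'` (`Iff.rfl`, cf. `signedExactCubicForrelationProblem_two_eq`);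
* `SignedExactCubicForrelationInPrBPP_iff_not_notPrBPP` (and the tree-vocabulary form
  `signedExact_two_mem_PromiseBPP'_iff_not_notPrBPP`) — the item is EXACTLY the negation of crux r3
  `SignedExactCubicForrelationNotPrBPP` (stmt-QuantumAdvantage-13932): proving it closes r3 `refuted`,
  proving r3 refutes it;
* `signedExact_mem_PromiseBPP'_of_signed_mem`, `SignedExactCubicForrelationInPrBPP_of_SignedCubicForrelationInPrBPP`
  — crux r7 `SignedCubicForrelationInPrBPP` (stmt-QuantumAdvantage-13933) implies the item (antitonicity of
  `PromiseBPP'` in the promise: `Φ = 1 ⇒ Φ ≥ 3/5`, `Φ = -1 ⇒ Φ ≤ -3/5`; with the landed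
  `SignedExactHardImpliesTarget_proof` this is also "r7 refutes r3");
* (generic wrappers, sub-namespace `ExactSliceDeciders`:) `mem_PromiseP_of_fp_accept`, `mem_PromiseBPP'_of_fp_accept` — a promise problem decided on the promise by
  the acceptance test `f x = [true]` of ANY `f ∈ FP` is in `PromiseP ⊆ PromiseBPP'` (no coins, no one-bit
  normalisation: the witness language `{z | f z = [true]}` is in `P` by `setOf_apply_eq_apply_mem_P`);
* `mem_PromiseP_of_codeFP_accept`, `mem_PromiseBPP'_of_codeFP_accept` — the same for promise problems whose
  instances are Forrelation instance codes and a COIN-FREE acceptance bit `acc t |code|` computed on the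
  mirror instance `t = instOf I` in the `CodeFP` calculus (`ForrelationCircuitCode.lean`): the deterministic
  counterpart of `CubicDequant.mem_PromiseBPP'_of_accept` (`CubicForrelationEstimatorMachine.lean`), which is
  the shape of the `stub_plumbing` / `stub_exactDecider` stubs of the r3 lines `dual_pingpong_frame` /
  `oil_slice_radicals` (an M-subspace certificate is verified and the sign read off deterministically);
  `SignedExactCubicForrelationInPrBPP_of_codeFP_accept` is the item MODULO one such coin-free decider;
  `mem_PromiseP_of_codeFP_instAccept` / `SignedExactCubicForrelationInPrBPP_of_instAccept` are the same with the
  acceptance bit a function of the instance itself (`CodeFP encode bitE acc`) and the promise unpacked into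
  `IsOverB2`, `value = ±1`, `k = 2`, `Even n`, cubic;
* `mem_PromiseBPP'_of_codeFP_acceptCoins`, `SignedExactCubicForrelationInPrBPP_of_codeFP_acceptCoins`,
  `SignedExactCubicForrelationInPrBPP_of_instAcceptCoins` — the RANDOMISED wrapper: `CubicDequant.mem_PromiseBPP'_of_accept`
  with the estimator's `accept` abstracted to any acceptance bit `acc I y` of instance and coin string that is
  polynomial-time on codes (`CodeFP (pairE encode strE) bitE`), i.e. the shape of `stub_SignReadout` of the r3 line
  `stationary_flat_sign` (a Las-Vegas flat finder feeding a deterministic sign readout).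

What is NOT here: a proof of the item. By `SignedExactCubicForrelationInPrBPP_iff_not_notPrBPP` that is the
refutation of crux r3, whose open mathematics is a TOTAL polynomial-time finder of a bi-isotropic /
M-subspace for every exact cubic pair (worst case over biquadratic permutations — the `BQ∞ = ∅`
dichotomy of `Cruxes/SignedExactCubicForrelationNotPrBPP/TRIAGE-r1-2.md` §2) plus crux r5
`ExactPairsMaioranaMcFarland` for the non-Maiorana–McFarland pairs; the sign READOUT from such a subspace is
already a theorem (`DerivativeWalsh.sign_transport`, `coset_sum_eq_of_forrelation_eq_one/neg_one`,
`dual_affine_on_perp_cosets`).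
-/

set_option linter.dupNamespace false -- D-0017: single-problem summit ⇒ `QuantumAdvantage.QuantumAdvantage` by design

namespace Summit.QuantumAdvantage.QuantumAdvantage.Theorems

open Literature.Computability.QuantumComplexity Literature.Computability.Complexity
open Literature.Computability.Complexity.CodeFP (pairE strE bitE)
open Literature.Computability.Complexity.Brick (OneBit OneBit.comp oneBit_eqPairFn)
open Summit.QuantumAdvantage.QuantumAdvantage.Theses.CubicForrelation

/-! ### The item in the tree's vocabulary -/

/-- The route decl of item stmt-QuantumAdvantage-14671, `SignedExactCubicForrelationInPrBPP`, is (by `Iff.rfl`)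
membership of the tree's `signedExactCubicForrelationProblem 2` in `PromiseBPP'`. -/
theorem SignedExactCubicForrelationInPrBPP_iff :
    SignedExactCubicForrelationInPrBPP ↔ signedExactCubicForrelationProblem 2 ∈ PromiseBPP' :=
  Iff.rfl

/-- **The item is the negation of crux r3.** `signedExactCubicForrelationProblem 2 ∈ PromiseBPP'` iff
`¬ SignedExactCubicForrelationNotPrBPP` (the route decl of stmt-QuantumAdvantage-13932 is
`signedExactCubicForrelationProblem 2 ∉ PromiseBPP'` by `rfl`; classical double negation). -/
theorem signedExact_two_mem_PromiseBPP'_iff_not_notPrBPP :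
    signedExactCubicForrelationProblem 2 ∈ PromiseBPP' ↔ ¬ SignedExactCubicForrelationNotPrBPP := by
  unfold SignedExactCubicForrelationNotPrBPP
  exact not_not.symm

/-- **By name: item stmt-QuantumAdvantage-14671 ↔ ¬ crux r3 (stmt-QuantumAdvantage-13932).** Whoever lands either
side settles both items: `SignedExactCubicForrelationInPrBPP ↔ ¬ SignedExactCubicForrelationNotPrBPP`. -/
theorem SignedExactCubicForrelationInPrBPP_iff_not_notPrBPP :
    SignedExactCubicForrelationInPrBPP ↔ ¬ SignedExactCubicForrelationNotPrBPP :=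
  signedExact_two_mem_PromiseBPP'_iff_not_notPrBPP

/-! ### Down the promise: the signed problem decides its exact slice -/

/-- `PromiseBPP'` is antitone in the promise: if the signed cubic `k₀`-fold problem (YES `Φ ≥ 3/5`, NO
`Φ ≤ -3/5`) is in `PromiseBPP'` then so is its exact slice (YES `Φ = 1`, NO `Φ = -1`) — the same
`P`-predicate and coin polynomial work (`signedExactCubicForrelationProblem_yes_subset` /
`_no_subset`). Contrapositive of `signedCubicForrelationProblem_not_mem_PromiseBPP'_of_exact`. -/
theorem signedExact_mem_PromiseBPP'_of_signed_mem (k₀ : ℕ)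
    (h : signedCubicForrelationProblem k₀ ∈ PromiseBPP') :
    signedExactCubicForrelationProblem k₀ ∈ PromiseBPP' := by
  obtain ⟨L', hL', p, hyes, hno⟩ := h
  exact ⟨L', hL', p, fun x hx => hyes x (signedExactCubicForrelationProblem_yes_subset k₀ hx),
    fun x hx => hno x (signedExactCubicForrelationProblem_no_subset k₀ hx)⟩

/-- **Crux r7 implies the item** (by name): if signed cubic 2-fold Forrelation is in `PromiseBPP'`
(`SignedCubicForrelationInPrBPP`, stmt-QuantumAdvantage-13933) then so is its signed exact slice
(`SignedExactCubicForrelationInPrBPP`, stmt-QuantumAdvantage-14671). The converse is not claimed. -/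
theorem SignedExactCubicForrelationInPrBPP_of_SignedCubicForrelationInPrBPP :
    SignedCubicForrelationInPrBPP → SignedExactCubicForrelationInPrBPP :=
  signedExact_mem_PromiseBPP'_of_signed_mem 2

/-! ## Generic decider wrappers (sub-namespace `ExactSliceDeciders`) -/

namespace ExactSliceDeciders

/-! ### Deterministic deciders: `PromiseP ⊆ PromiseBPP'` from an `FP` acceptance test -/

/-- **A promise problem decided by the acceptance test of an `FP` function is in `PromiseP`.** If
`f ∈ FP` answers `[true]` on every yes-instance and anything else on every no-instance, the language
`{z | f z = [true]} ∈ P` (`setOf_apply_eq_apply_mem_P`, an equality test of two `FP` maps) separates the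
promise. Nothing is required off the promise, and `f` need not be one-bit there. -/
theorem mem_PromiseP_of_fp_accept (Q : PromiseProblem) {f : List Bool → List Bool} (hf : f ∈ FP)
    (hyes : ∀ x ∈ Q.yes, f x = [true]) (hno : ∀ x ∈ Q.no, f x ≠ [true]) : Q ∈ PromiseP :=
  ⟨{z | f z = [true]}, setOf_apply_eq_apply_mem_P hf (const_mem_FP [true]),
    fun x hx => hyes x hx, fun x hx => hno x hx⟩

/-- … hence in `PromiseBPP'` (`PromiseP_subset_PromiseBPP'`: ignore the coins). -/
theorem mem_PromiseBPP'_of_fp_accept (Q : PromiseProblem) {f : List Bool → List Bool} (hf : f ∈ FP)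
    (hyes : ∀ x ∈ Q.yes, f x = [true]) (hno : ∀ x ∈ Q.no, f x ≠ [true]) : Q ∈ PromiseBPP' :=
  PromiseP_subset_PromiseBPP' (mem_PromiseP_of_fp_accept Q hf hyes hno)

/-- **Coin-free deciders on Forrelation instance codes.** Let `Q` be a promise problem all of whose
instances are codes of `KForrelationInstance`s, and let `acc t L : Bool` be an acceptance bit of the mirror
instance `t : ForrCode.Inst` and the code length `L`, computed on codes in polynomial time
(`CodeFP instE bitE (fun t => acc t |instE t|)`, assembled in the `CodeFP` calculus from
`ForrelationCircuitCode.lean` exactly like `CubicDequant.accept_codeFP`, minus the coin argument). If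
`acc (instOf I) |encode I|` is `true` on yes-codes and `false` on no-codes then `Q ∈ PromiseP`. -/
theorem mem_PromiseP_of_codeFP_accept (Q : PromiseProblem) (acc : ForrCode.Inst → ℕ → Bool)
    (hacc : CodeFP ForrCode.instE CodeFP.bitE fun t => acc t (ForrCode.instE t).length)
    (hyes : ∀ I : KForrelationInstance, I.encode ∈ Q.yes → acc (ForrCode.instOf I) I.encode.length = true)
    (hno : ∀ I : KForrelationInstance, I.encode ∈ Q.no → acc (ForrCode.instOf I) I.encode.length = false)
    (hY : ∀ x ∈ Q.yes, ∃ I : KForrelationInstance, I.encode = x)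
    (hN : ∀ x ∈ Q.no, ∃ I : KForrelationInstance, I.encode = x) : Q ∈ PromiseP := by
  obtain ⟨f, hf, hspec⟩ := hacc
  refine mem_PromiseP_of_fp_accept Q hf (fun x hx => ?_) (fun x hx => ?_)
  · obtain ⟨I, rfl⟩ := hY x hx
    have h := hyes I hx
    rw [ForrCode.encode_eq] at h ⊢
    rw [hspec]
    show [acc (ForrCode.instOf I) (ForrCode.instE (ForrCode.instOf I)).length] = [true]
    rw [h]
  · obtain ⟨I, rfl⟩ := hN x hx
    have h := hno I hx
    rw [ForrCode.encode_eq] at h ⊢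
    rw [hspec]
    show [acc (ForrCode.instOf I) (ForrCode.instE (ForrCode.instOf I)).length] ≠ [true]
    rw [h]
    decide

/-- … hence `Q ∈ PromiseBPP'`: the deterministic counterpart of `CubicDequant.mem_PromiseBPP'_of_accept`
(no coin polynomial, no Chebyshev), i.e. the wrapper a certified-flat sign decider of the exact slice
ends with. -/
theorem mem_PromiseBPP'_of_codeFP_accept (Q : PromiseProblem) (acc : ForrCode.Inst → ℕ → Bool)
    (hacc : CodeFP ForrCode.instE CodeFP.bitE fun t => acc t (ForrCode.instE t).length)
    (hyes : ∀ I : KForrelationInstance, I.encode ∈ Q.yes → acc (ForrCode.instOf I) I.encode.length = true)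
    (hno : ∀ I : KForrelationInstance, I.encode ∈ Q.no → acc (ForrCode.instOf I) I.encode.length = false)
    (hY : ∀ x ∈ Q.yes, ∃ I : KForrelationInstance, I.encode = x)
    (hN : ∀ x ∈ Q.no, ∃ I : KForrelationInstance, I.encode = x) : Q ∈ PromiseBPP' :=
  PromiseP_subset_PromiseBPP' (mem_PromiseP_of_codeFP_accept Q acc hacc hyes hno hY hN)

/-- The instances of the signed exact slice are instance codes (yes-side). -/
theorem signedExact_yes_codes (k₀ : ℕ) :
    ∀ x ∈ (signedExactCubicForrelationProblem k₀).yes, ∃ I : KForrelationInstance, I.encode = x := by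
  rintro x ⟨I, -, rfl⟩
  exact ⟨I, rfl⟩

/-- The instances of the signed exact slice are instance codes (no-side). -/
theorem signedExact_no_codes (k₀ : ℕ) :
    ∀ x ∈ (signedExactCubicForrelationProblem k₀).no, ∃ I : KForrelationInstance, I.encode = x := by
  rintro x ⟨I, -, rfl⟩
  exact ⟨I, rfl⟩

/-! ### Instance-level coin-free deciders -/

/-- **Coin-free deciders as functions of the instance.** If an acceptance bit `acc I : Bool` of the
Forrelation instance is polynomial-time on instance codes (`CodeFP encode bitE acc`), `true` on the
instances whose codes are yes-instances of `Q` and `false` on those whose codes are no-instances, and all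
instances of `Q` are instance codes, then `Q ∈ PromiseP`. -/
theorem mem_PromiseP_of_codeFP_instAccept (Q : PromiseProblem) (acc : KForrelationInstance → Bool)
    (hacc : CodeFP KForrelationInstance.encode bitE acc)
    (hyes : ∀ I : KForrelationInstance, I.encode ∈ Q.yes → acc I = true)
    (hno : ∀ I : KForrelationInstance, I.encode ∈ Q.no → acc I = false)
    (hY : ∀ x ∈ Q.yes, ∃ I : KForrelationInstance, I.encode = x)
    (hN : ∀ x ∈ Q.no, ∃ I : KForrelationInstance, I.encode = x) : Q ∈ PromiseP := by
  obtain ⟨f, hf, hspec⟩ := hacc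
  refine mem_PromiseP_of_fp_accept Q hf (fun x hx => ?_) (fun x hx => ?_)
  · obtain ⟨I, rfl⟩ := hY x hx
    rw [show f I.encode = [acc I] from hspec I, hyes I hx]
  · obtain ⟨I, rfl⟩ := hN x hx
    rw [show f I.encode = [acc I] from hspec I, hno I hx]
    decide

/-! ### Randomised deciders: `CubicDequant.mem_PromiseBPP'_of_accept` for any acceptance bit -/

/-- **Promise-`BPP'` membership from acceptance bounds of ANY polynomial-time acceptance bit with coins.**
Let `Q` be a promise problem whose instances are Forrelation instance codes and `acc I y : Bool` an
acceptance bit of instance and coin string, polynomial-time on codes (`CodeFP (pairE encode strE) bitE`). If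
for a polynomial `p` a `≥ 2/3` fraction of the coin strings of length `p |encode I|` accept on yes-codes and a
`≥ 2/3` fraction reject on no-codes, then `Q ∈ PromiseBPP'`: the one-bit normalisation
`dec = eqPairFn ∘ fanoutFn f [true]` of the `FP` witness `f` is fed to `PromiseProblem.mem_PromiseBPP'_of_fp_decider`
(this is `CubicDequant.mem_PromiseBPP'_of_accept` with the estimator's `accept` abstracted). -/
theorem mem_PromiseBPP'_of_codeFP_acceptCoins (Q : PromiseProblem) (acc : KForrelationInstance → List Bool → Bool)
    (hacc : CodeFP (pairE KForrelationInstance.encode strE) bitE fun q => acc q.1 q.2)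
    (p : Polynomial ℕ)
    (hyes : ∀ I : KForrelationInstance, I.encode ∈ Q.yes →
      (2 / 3 : ℝ) ≤ uniformProb (p.eval I.encode.length) {y | acc I y = true})
    (hno : ∀ I : KForrelationInstance, I.encode ∈ Q.no →
      (2 / 3 : ℝ) ≤ uniformProb (p.eval I.encode.length) {y | acc I y = false})
    (hY : ∀ x ∈ Q.yes, ∃ I : KForrelationInstance, I.encode = x)
    (hN : ∀ x ∈ Q.no, ∃ I : KForrelationInstance, I.encode = x) : Q ∈ PromiseBPP' := by
  obtain ⟨f, hf, hspec⟩ := hacc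
  have hdec : (eqPairFn ∘ fanoutFn f fun _ => [true]) ∈ FP :=
    comp_mem_FP eqPairFn_mem_FP (fanoutFn_mem_FP hf (const_mem_FP _))
  have h1 : OneBit (eqPairFn ∘ fanoutFn f fun _ => [true]) := OneBit.comp oneBit_eqPairFn _
  have hdecI : ∀ (I : KForrelationInstance) (y : List Bool),
      (eqPairFn ∘ fanoutFn f fun _ => [true]) (boolPair I.encode y) = [acc I y] := by
    intro I y
    rw [Function.comp_apply, fanoutFn_apply, eqPairFn_boolPair,
      show f (boolPair I.encode y) = [acc I y] from hspec (I, y)]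
    cases acc I y <;> rfl
  refine Q.mem_PromiseBPP'_of_fp_decider hdec h1 p (fun x hx => ?_) (fun x hx => ?_)
  · obtain ⟨I, rfl⟩ := hY x hx
    refine (hyes I hx).trans_eq (congrArg _ (Set.ext fun y => ?_))
    show acc I y = true ↔ (eqPairFn ∘ fanoutFn f fun _ => [true]) (boolPair I.encode y) = [true]
    rw [hdecI]
    cases acc I y <;> simp
  · obtain ⟨I, rfl⟩ := hN x hx
    refine (hno I hx).trans_eq (congrArg _ (Set.ext fun y => ?_))
    show acc I y = false ↔ (eqPairFn ∘ fanoutFn f fun _ => [true]) (boolPair I.encode y) = [false]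
    rw [hdecI]
    cases acc I y <;> simp

end ExactSliceDeciders

/-! ## The item modulo ONE decider (route decl by name) -/

open ExactSliceDeciders

/-- **Reduction of the item to one coin-free `CodeFP` sign decider** (concluding the route decl by name). The item
`SignedExactCubicForrelationInPrBPP` (`= signedExactCubicForrelationProblem 2 ∈ PromiseBPP'`, `↔ ¬` crux r3) follows from any
acceptance bit `acc t |code|`, polynomial-time on codes, that is `true` on the codes of exact pairs with
`Φ = 1` and `false` on those with `Φ = -1` (`k = 2`, `n` even, `B₂`-circuits of `𝔽₂`-degree `≤ 3`). This is
the exact shape of the machine the r3 refutation lines build from a certified M-subspace / bi-isotropic flat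
(sign readout `Φ = (-1)^{a(0)} (-1)^{b(μ)}`). -/
theorem SignedExactCubicForrelationInPrBPP_of_codeFP_accept (acc : ForrCode.Inst → ℕ → Bool)
    (hacc : CodeFP ForrCode.instE CodeFP.bitE fun t => acc t (ForrCode.instE t).length)
    (hyes : ∀ I : KForrelationInstance, I.encode ∈ (signedExactCubicForrelationProblem 2).yes →
      acc (ForrCode.instOf I) I.encode.length = true)
    (hno : ∀ I : KForrelationInstance, I.encode ∈ (signedExactCubicForrelationProblem 2).no →
      acc (ForrCode.instOf I) I.encode.length = false) :
    SignedExactCubicForrelationInPrBPP :=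
  mem_PromiseBPP'_of_codeFP_accept _ acc hacc hyes hno (signedExact_yes_codes 2) (signedExact_no_codes 2)

/-- **The item from one coin-free polynomial-time sign bit of the instance** (route decl by name, promise
unpacked): if `acc I` is polynomial-time on codes, `true` on every `B₂`-instance with `Φ = 1`, `k = 2`,
`n` even and cubic oracles, and `false` on every such instance with `Φ = -1`, then
`SignedExactCubicForrelationInPrBPP` (indeed the exact slice is then in `PromiseP`). -/
theorem SignedExactCubicForrelationInPrBPP_of_instAccept (acc : KForrelationInstance → Bool)
    (hacc : CodeFP KForrelationInstance.encode bitE acc)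
    (hyes : ∀ I : KForrelationInstance, I.IsOverB2 → I.value = 1 → I.k = 2 → Even I.n →
      (∀ i, IsDegLeFun 3 (I.C i).eval) → acc I = true)
    (hno : ∀ I : KForrelationInstance, I.IsOverB2 → I.value = -1 → I.k = 2 → Even I.n →
      (∀ i, IsDegLeFun 3 (I.C i).eval) → acc I = false) :
    SignedExactCubicForrelationInPrBPP :=
  PromiseP_subset_PromiseBPP' <|
    mem_PromiseP_of_codeFP_instAccept _ acc hacc
      (fun I hI => by
        obtain ⟨h₁, h₂, h₃, h₄, h₅⟩ := (encode_mem_signedExactCubicForrelationProblem_yes_iff 2 I).1 hI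
        exact hyes I h₁ h₂ h₃ h₄ h₅)
      (fun I hI => by
        obtain ⟨h₁, h₂, h₃, h₄, h₅⟩ := (encode_mem_signedExactCubicForrelationProblem_no_iff 2 I).1 hI
        exact hno I h₁ h₂ h₃ h₄ h₅)
      (signedExact_yes_codes 2) (signedExact_no_codes 2)

/-- **Reduction of the item to acceptance bounds of one randomised polynomial-time acceptance bit** (route decl
by name): `SignedExactCubicForrelationInPrBPP` follows from any `acc I y`, polynomial-time on codes, accepting
`≥ 2/3` of the coin strings of length `p |encode I|` on the yes-codes of the exact slice and rejecting `≥ 2/3` on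
its no-codes. -/
theorem SignedExactCubicForrelationInPrBPP_of_codeFP_acceptCoins (acc : KForrelationInstance → List Bool → Bool)
    (hacc : CodeFP (pairE KForrelationInstance.encode strE) bitE fun q => acc q.1 q.2)
    (p : Polynomial ℕ)
    (hyes : ∀ I : KForrelationInstance, I.encode ∈ (signedExactCubicForrelationProblem 2).yes →
      (2 / 3 : ℝ) ≤ uniformProb (p.eval I.encode.length) {y | acc I y = true})
    (hno : ∀ I : KForrelationInstance, I.encode ∈ (signedExactCubicForrelationProblem 2).no →
      (2 / 3 : ℝ) ≤ uniformProb (p.eval I.encode.length) {y | acc I y = false}) :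
    SignedExactCubicForrelationInPrBPP :=
  mem_PromiseBPP'_of_codeFP_acceptCoins _ acc hacc p hyes hno (signedExact_yes_codes 2) (signedExact_no_codes 2)

/-- **The item from a randomised sign bit, promise unpacked**: the form a Las-Vegas flat finder followed by a
deterministic sign readout delivers (`acc I y = true` iff the run on coins `y` certifies a flat and reads
`Φ = 1`; on `Φ = 1` instances it must succeed for `≥ 2/3` of the coins, on `Φ = -1` instances it must answer
`false` for `≥ 2/3` of them — e.g. never accept without a certificate and find one with probability `≥ 2/3`). -/
theorem SignedExactCubicForrelationInPrBPP_of_instAcceptCoins (acc : KForrelationInstance → List Bool → Bool)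
    (hacc : CodeFP (pairE KForrelationInstance.encode strE) bitE fun q => acc q.1 q.2)
    (p : Polynomial ℕ)
    (hyes : ∀ I : KForrelationInstance, I.IsOverB2 → I.value = 1 → I.k = 2 → Even I.n →
      (∀ i, IsDegLeFun 3 (I.C i).eval) →
        (2 / 3 : ℝ) ≤ uniformProb (p.eval I.encode.length) {y | acc I y = true})
    (hno : ∀ I : KForrelationInstance, I.IsOverB2 → I.value = -1 → I.k = 2 → Even I.n →
      (∀ i, IsDegLeFun 3 (I.C i).eval) →
        (2 / 3 : ℝ) ≤ uniformProb (p.eval I.encode.length) {y | acc I y = false}) :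
    SignedExactCubicForrelationInPrBPP :=
  SignedExactCubicForrelationInPrBPP_of_codeFP_acceptCoins acc hacc p
    (fun I hI => by
      obtain ⟨h₁, h₂, h₃, h₄, h₅⟩ := (encode_mem_signedExactCubicForrelationProblem_yes_iff 2 I).1 hI
      exact hyes I h₁ h₂ h₃ h₄ h₅)
    (fun I hI => by
      obtain ⟨h₁, h₂, h₃, h₄, h₅⟩ := (encode_mem_signedExactCubicForrelationProblem_no_iff 2 I).1 hI
      exact hno I h₁ h₂ h₃ h₄ h₅)

end Summit.QuantumAdvantage.QuantumAdvantage.Theorems
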